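import Summits.Ventures.YMGap.Thresholds.StarWindowBoundLemmaG
import Summits.Ventures.YMGap.Thresholds.StarRows
import Summits.Ventures.YMGap.Thresholds.StarFrontLemmaG
import HarnessLib

/-!
# Venture YMGap — track (c) «DS», brick B4b (iv): the UNCONDITIONAL clustering rows and fronts for
# `SU(2)`, `d = 4` from Lemma G — every `0 ≤ β_W ≤ 9/25`; rows `1/3`, `7/20`; fronts `1/6`, `9/50`

HONEST FRAMING: venture file (cell `pub-ymgap`, PLAN R96/R99/R102), strong-coupling LATTICE statements
(currency SC-a: exponential clustering of link observables of the torus Wilson measure, uniformly in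
the side `L`; and the crossover ledger's `StrongCouplingFront`).  GLUE ONLY: the star door
(`DSWindow.su2Star_abs_covariance_le`, the named rows of `StarRows`, ds-1's
`su2_strongCouplingFront_*_of_lemmaG`) fed with `StarLemmaG.starWindowBound_lemmaG`; since
`R_G(β_W) < 1` iff `β_W < (√37 − 5)/3 = 0.3609…`, the rows close at every `β_W ≤ 9/25`.  Nothing about
the continuum, confinement at weak coupling, or the mass gap.
-/

noncomputable section

open MeasureTheory Function Finset ProbabilityTheory
open Literature.Probability.LatticeModels
open Literature.MathematicalPhysics.QuantumLattice (fundamentalRep fundamentalLatticeRep)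
open Literature.MathematicalPhysics.QuantumFieldTheory
open Literature.MathematicalPhysics.QuantumFieldTheory.Balaban1983to89
open Literature.MathematicalPhysics.QuantumFieldTheory.Balaban1983to89.StrongCouplingTorusWindow
open Summit.Ventures.YMGap.DSWindow
open Summit.Ventures.YMGap.StarWindowGauge (gaugeR)

namespace Summit.Ventures.YMGap.StarLemmaG

variable {L : ℕ} [NeZero L]

/-! ### Unconditional clustering rows -/

/-- `R_G(β) ≥ 0` for `0 ≤ β ≤ 7/10`. [folklore] -/
theorem gaugeR_nonneg {β : ℝ} (h0 : 0 ≤ β) (h1 : β ≤ 7 / 10) : 0 ≤ gaugeR β := by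
  rw [StarWindowGauge.gaugeR_eq_count h0 h1]
  obtain ⟨hb, hbb, hab, hg⟩ := StarWindowGauge.colB_nonneg (c := β / 4) (by linarith) (by linarith)
  exact mul_nonneg (by linarith) (by linarith)

/-- **SC-a for `SU(2)`, `d = 4`, at every `0 ≤ β_W ≤ 9/25`, unconditionally**: for admissible link
observables `f, g` (`DSWindow.LinkObs r`, any link weight `r ≤ R` dominated as in the door — here the
door is used with `r = suFrobDist`, `R = 2√2`) whose links are `≥ L₀` apart, under the torus Wilson
measure at tree coupling `β_W/2`, side `L ≥ 3`:
`|cov(f, g)| ≤ 4 (2√2)² exp(−((1 − R_G)²/(2(16 R_G + 1))) L₀) (Σδf)(Σδg)`, `R_G = gaugeR β_W < 1`,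
uniformly in `L`. [folklore] -/
theorem su2Star_abs_covariance_le_of_le_9_25 (hL : 3 ≤ L) {βW : ℝ} (h0 : 0 ≤ βW) (h : βW ≤ 9 / 25)
    {f g : GaugeConfig 4 L (Matrix.specialUnitaryGroup (Fin 2) ℂ) → ℝ} {Δf Δg : Finset (Edge 4 L)} {δf δg : Edge 4 L → ℝ}
    (hf : LinkObs suFrobDist f Δf δf) (hg : LinkObs suFrobDist g Δg δg) (L₀ : ℕ)
    (hL₀ : ∀ x ∈ Δf, ∀ z ∈ Δg, ∀ a ∈ linkEnds x, ∀ w ∈ linkEnds z, L₀ ≤ torusNorm (a - w)) :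
    |cov[f, g; wilsonMeasure (d := 4) (L := L) (fundamentalRep (Fin 2)) (βW / 2)]| ≤
      4 * (2 * Real.sqrt 2) ^ 2 *
        Real.exp (-((1 - gaugeR βW) ^ 2 / (2 * (16 * gaugeR βW + 1)) * L₀)) *
        (∑ x ∈ Δf, δf x) * ∑ y ∈ Δg, δg y :=
  su2Star_abs_covariance_le βW (by positivity) (fun a b => by simpa using suFrobDist_le (N := 2) a b)
    (gaugeR_nonneg h0 (by linarith)) (StarWindowGauge.gaugeR_lt_one_of_le h0 h)
    (starWindowBound_lemmaG hL h0 (by linarith)) hf hg L₀ hL₀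

/-- **Row of record `β_W = 1/3`, unconditional** (PLAN R96): rate `2/3345`. [folklore] -/
theorem su2Star_abs_covariance_le_oneThird' (hL : 3 ≤ L) {R : ℝ} (hR : 0 ≤ R)
    (hrR : ∀ a b : (Matrix.specialUnitaryGroup (Fin 2) ℂ), suFrobDist a b ≤ R)
    {f g : GaugeConfig 4 L (Matrix.specialUnitaryGroup (Fin 2) ℂ) → ℝ} {Δf Δg : Finset (Edge 4 L)} {δf δg : Edge 4 L → ℝ}
    (hf : LinkObs suFrobDist f Δf δf) (hg : LinkObs suFrobDist g Δg δg) (L₀ : ℕ)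
    (hL₀ : ∀ x ∈ Δf, ∀ z ∈ Δg, ∀ a ∈ linkEnds x, ∀ w ∈ linkEnds z, L₀ ≤ torusNorm (a - w)) :
    |cov[f, g; wilsonMeasure (d := 4) (L := L) (fundamentalRep (Fin 2)) ((1 / 3 : ℝ) / 2)]| ≤
      4 * R ^ 2 * Real.exp (-((2 / 3345 : ℝ) * L₀)) * (∑ x ∈ Δf, δf x) * ∑ y ∈ Δg, δg y :=
  StarRows.su2Star_abs_covariance_le_oneThird hR hrR
    (starWindowBound_lemmaG hL (by norm_num) (by norm_num)) hf hg L₀ hL₀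

/-- **Row `β_W = 7/20`, unconditional** (PLAN R94/R99): `γ₀ = 1827/1933`. [folklore] -/
theorem su2Star_abs_covariance_le_7_20' (hL : 3 ≤ L) {R : ℝ} (hR : 0 ≤ R)
    (hrR : ∀ a b : (Matrix.specialUnitaryGroup (Fin 2) ℂ), suFrobDist a b ≤ R)
    {f g : GaugeConfig 4 L (Matrix.specialUnitaryGroup (Fin 2) ℂ) → ℝ} {Δf Δg : Finset (Edge 4 L)} {δf δg : Edge 4 L → ℝ}
    (hf : LinkObs suFrobDist f Δf δf) (hg : LinkObs suFrobDist g Δg δg) (L₀ : ℕ)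
    (hL₀ : ∀ x ∈ Δf, ∀ z ∈ Δg, ∀ a ∈ linkEnds x, ∀ w ∈ linkEnds z, L₀ ≤ torusNorm (a - w)) :
    |cov[f, g; wilsonMeasure (d := 4) (L := L) (fundamentalRep (Fin 2)) ((7 / 20 : ℝ) / 2)]| ≤
      4 * R ^ 2 * Real.exp (-((1 - (1827 / 1933 : ℝ)) ^ 2 / (2 * (16 * (1827 / 1933 : ℝ) + 1)) * L₀)) *
        (∑ x ∈ Δf, δf x) * ∑ y ∈ Δg, δg y :=
  StarRows.su2Star_abs_covariance_le_7_20 hR hrR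
    (starWindowBound_lemmaG hL (by norm_num) (by norm_num)) hf hg L₀ hL₀


/-- **The strong-coupling FRONT of the crossover ledger at Wilson `β_W = 1/3` (tree coupling `1/6`)
for `SU(2)`, `d = 4` — unconditionally** (ds-1's `su2_strongCouplingFront_oneSixth_of_lemmaG` fed
with `starWindowBound_lemmaG`): exponential clustering of link observables on all odd-side tori,
uniformly, at every coupling up to `1/6`. Strong-coupling statement; nothing about the continuum or
the mass gap. [folklore] -/
theorem su2_strongCouplingFront_oneSixth :
    CrossoverLedger.StrongCouplingFront (fundamentalLatticeRep 2) (1 / 6) :=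
  su2_strongCouplingFront_oneSixth_of_lemmaG fun L _ hL βW h0 h1 => by
    exact starWindowBound_lemmaG (L := L) hL h0 (by linarith)


/-- **The strong-coupling FRONT at Wilson `β_W = 9/25` (tree coupling `9/50`) for `SU(2)`, `d = 4` —
the cell's headline of record (PLAN R99), unconditionally** (ds-1's
`su2_strongCouplingFront_of_lemmaG` at `β₀ = 9/25`, `R_G(9/25) = 2943/2957 < 1`, fed with
`starWindowBound_lemmaG`). Strong-coupling statement; nothing about the continuum or the mass gap.
[folklore] -/
theorem su2_strongCouplingFront_9_50 :
    CrossoverLedger.StrongCouplingFront (fundamentalLatticeRep 2) (9 / 50) := by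
  rw [show (9 / 50 : ℝ) = (9 / 25) / 2 by norm_num]
  exact su2_strongCouplingFront_of_lemmaG (9 / 25) (by norm_num) (by norm_num)
    (by rw [StarWindowGauge.gaugeR_9_25]; norm_num)
    fun L _ hL βW h0 h1 => by exact starWindowBound_lemmaG (L := L) hL h0 (by linarith)

end Summit.Ventures.YMGap.StarLemmaG

end
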